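/-
Copyright (c) 2026. All rights reserved.
Released under Apache 2.0 license as described in the file LICENSE.
-/
import Mathlib.MeasureTheory.Integral.IntervalIntegral.Periodic
import Mathlib.MeasureTheory.Constructions.Pi
import Mathlib.MeasureTheory.Function.Floor
import Literature.Analysis.FunctionSpaces.BochnerProofs
import HarnessLib

/-!
# Herglotz's theorem: positive-definite functions on `ℤᵈ`

A function `C : ℤᵈ → ℂ` is positive definite (`Literature.Analysis.FunctionSpaces.IsPositiveDefinite`,
the convention `∑ᵢⱼ conj cᵢ cⱼ C (xⱼ - xᵢ) ≥ 0`) if and only if it is the sequence of Fourier–Stieltjes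
coefficients of a finite positive measure on the torus `𝕋ᵈ` (Herglotz 1911 for `d = 1`; the case of a
general locally compact abelian group is Weil's generalisation of the Herglotz–Bochner theorem).
Katznelson, *An Introduction to Harmonic Analysis*, Ch. I §7.6 Theorem (Herglotz) and Ch. VII §4.
[cite: Katznelson2004, Ch. I §7.6 Theorem (Herglotz); Ch. VII §4]

We prove the existence half for `ℤᵈ` by REDUCTION TO BOCHNER'S THEOREM ON `ℝᵈ`, which is a theorem of
this library (`Literature.Analysis.FunctionSpaces.bochner_holds`, file `BochnerProofs`): the
*tent interpolant*
`C̃ (u) := ∫_{𝕋ᵈ} C (⌊u - θ⌋ - ⌊0 - θ⌋) dθ = ∑_r C r · ∏ᵢ (1 - |uᵢ - rᵢ|)₊`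
of `C` is continuous, positive definite on `ℝᵈ` (for each `θ` the quadratic form of `C̃` at points
`x₁, …, xₙ ∈ ℝᵈ` is the `θ`-average of the quadratic form of `C` at the integer points `⌊xₖ - θ⌋`),
agrees with `C` on `ℤᵈ`, and Bochner's theorem represents it as the characteristic function of a finite
measure `μ` on `ℝᵈ`; restricting to integer frequencies, `C r = ∫ exp (i r·ξ) dμ(ξ)` for all `r ∈ ℤᵈ`
(Mathlib's `charFun` sign convention; Katznelson's `μ̂(n) = ∫ e^{-int} dμ` is obtained by reflecting
`μ`). The representing measure is stated on `ℝᵈ` (any finite measure whose Fourier transform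
interpolates `C` at the integer points); its push-forward to `ℝᵈ / 2πℤᵈ` is the (unique) spectral
measure of the printed statement. (The KERNEL CEILING used with such representations — for a finitely
supported kernel `k` with `K (p) = ∑_r k r cos (r·p) ≥ 0`, `K(0) · μ (Q + 2πℤᵈ) ≤ ∑_r k r · Re (e^{-i r·Q} C r)`
— is our own corollary and lives on the venture side, not in `Literature/`.)

NOT here: uniqueness (it holds for the push-forward to the torus, not for the measure on `ℝᵈ`), the
closed tent formula for `C̃`, and Bochner's theorem for general LCA groups.

## Main statements

* `IsPositiveDefinite.exists_measure_integral_exp_eq` — Herglotz's theorem on `ℤᵈ` (existence of a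
  representing finite measure). [cite: Katznelson2004, Ch. I §7.6 Theorem (Herglotz)]
* `isPositiveDefinite_of_integral_exp_eq` — the easy converse. [cite: Katznelson2004, Ch. I §7.6 (7.8)]

## References

* [Katznelson2004] Y. Katznelson, *An Introduction to Harmonic Analysis*, 3rd ed., CUP 2004,
  Ch. I §7.6 (Herglotz), Ch. VI §2.8 (Bochner), Ch. VII §4 (Weil).
* [Bochner1933] S. Bochner, Math. Ann. 108 (1933), Satz 22.
-/

open MeasureTheory Complex Filter Topology
open scoped Real ComplexConjugate

noncomputable section

namespace Literature.Analysis.FunctionSpaces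

namespace HerglotzZd

/-! ### The binning difference `⌊a - t⌋ - ⌊b - t⌋` and its lift to the circle `ℝ / ℤ` -/

/-- The binning difference `δ_{a,b}(t) = ⌊a - t⌋ - ⌊b - t⌋`. [folklore] -/
def binDiff (a b t : ℝ) : ℤ := ⌊a - t⌋ - ⌊b - t⌋

/-- `δ_{a,b}` is `1`-periodic. [folklore] -/
private theorem binDiff_periodic (a b : ℝ) : Function.Periodic (binDiff a b) 1 := by
  intro t
  simp only [binDiff]
  have h1 : a - (t + 1) = (a - t) + ((-1 : ℤ) : ℝ) := by push_cast; ring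
  have h2 : b - (t + 1) = (b - t) + ((-1 : ℤ) : ℝ) := by push_cast; ring
  rw [h1, h2, Int.floor_add_intCast, Int.floor_add_intCast]
  ring

/-- `δ_{a,b}` is measurable. [folklore] -/
private theorem measurable_binDiff (a b : ℝ) : Measurable (binDiff a b) :=
  ((measurable_const.sub measurable_id).floor).sub ((measurable_const.sub measurable_id).floor)

/-- Simultaneous translation of `a, b` is a translation of the argument. [folklore] -/
private theorem binDiff_add_right (a b s t : ℝ) : binDiff (a + s) (b + s) t = binDiff a b (t - s) := by
  simp only [binDiff]
  congr 2 <;> ring_nf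

/-- `δ_{a,a} = 0`. [folklore] -/
@[simp] private theorem binDiff_self (a t : ℝ) : binDiff a a t = 0 := by simp [binDiff]

/-- At an integer point, `δ_{r,0} = r`. [folklore] -/
private theorem binDiff_intCast_zero (r : ℤ) (t : ℝ) : binDiff r 0 t = r := by
  unfold binDiff
  rw [show (r : ℝ) - t = r + (-t) by ring, Int.floor_intCast_add, zero_sub]
  ring

/-- The binning difference as a function on the circle `AddCircle 1 = ℝ / ℤ`. [folklore] -/
def binDiffCirc (a b : ℝ) : AddCircle (1 : ℝ) → ℤ :=
  AddCircle.liftIco 1 0 (binDiff a b)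

/-- The circle lift agrees with `δ_{a,b}` on representatives. [folklore] -/
private theorem binDiffCirc_coe (a b t : ℝ) : binDiffCirc a b (t : AddCircle (1 : ℝ)) = binDiff a b t := by
  obtain ⟨t₀, ht₀, h⟩ := AddCircle.eq_coe_Ico (p := (1 : ℝ)) (t : AddCircle (1 : ℝ))
  rw [← h]
  unfold binDiffCirc
  rw [AddCircle.liftIco_coe_apply (by simpa using ht₀)]
  -- `↑t₀ = ↑t` forces `t = t₀ + n` for an integer `n`; use periodicity
  obtain ⟨n, hn⟩ : ∃ n : ℤ, t = t₀ + n := by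
    have h' := QuotientAddGroup.eq.mp h
    obtain ⟨k, hk⟩ := AddSubgroup.mem_zmultiples_iff.mp h'
    refine ⟨k, ?_⟩
    simp only [zsmul_eq_mul, mul_one] at hk
    linarith
  rw [hn]
  exact ((binDiff_periodic a b).int_mul n t₀).symm.trans (by simp)

/-- The circle lift is measurable. [folklore] -/
private theorem measurable_binDiffCirc (a b : ℝ) : Measurable (binDiffCirc a b) := by
  have h : binDiffCirc a b = (binDiff a b ∘ Subtype.val) ∘ (AddCircle.measurableEquivIco (1 : ℝ) 0) :=
    rfl
  rw [h]
  exact ((measurable_binDiff a b).comp measurable_subtype_coe).comp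
    (AddCircle.measurableEquivIco (1 : ℝ) 0).measurable

/-- Translation covariance of the circle lift. [folklore] -/
private theorem binDiffCirc_add_right (a b s : ℝ) (θ : AddCircle (1 : ℝ)) :
    binDiffCirc (a + s) (b + s) θ = binDiffCirc a b (θ - (s : AddCircle (1 : ℝ))) := by
  obtain ⟨t, rfl⟩ := QuotientAddGroup.mk_surjective θ
  change binDiffCirc (a + s) (b + s) (t : AddCircle (1 : ℝ)) =
    binDiffCirc a b ((t : AddCircle (1 : ℝ)) - (s : AddCircle (1 : ℝ)))
  rw [← QuotientAddGroup.mk_sub, binDiffCirc_coe, binDiffCirc_coe, binDiff_add_right]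

/-- `δ_{a,a} = 0` on the circle. [folklore] -/
@[simp] private theorem binDiffCirc_self (a : ℝ) (θ : AddCircle (1 : ℝ)) : binDiffCirc a a θ = 0 := by
  obtain ⟨t, rfl⟩ := QuotientAddGroup.mk_surjective θ
  exact (binDiffCirc_coe a a t).trans (binDiff_self a t)

/-- At an integer point the circle lift is constant `r`. [folklore] -/
private theorem binDiffCirc_intCast_zero (r : ℤ) (θ : AddCircle (1 : ℝ)) : binDiffCirc r 0 θ = r := by
  obtain ⟨t, rfl⟩ := QuotientAddGroup.mk_surjective θ
  exact (binDiffCirc_coe r 0 t).trans (binDiff_intCast_zero r t)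

/-! ### The torus average kernel and the tent interpolant -/

variable {d : ℕ}

/-- The `d`-torus `(ℝ / ℤ)ᵈ` carrying the product of the Haar probability measures (plumbing). [folklore] -/
abbrev Torus (d : ℕ) : Type := Fin d → AddCircle (1 : ℝ)

/-- Haar measure on `ℝ / ℤ` is a probability measure. [folklore] -/
instance : IsProbabilityMeasure (volume : Measure (AddCircle (1 : ℝ))) :=
  ⟨by rw [AddCircle.measure_univ]; simp⟩

/-- The integer-point map `θ ↦ (⌊xᵢ - θᵢ⌋ - ⌊yᵢ - θᵢ⌋)ᵢ` on the torus. [folklore] -/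
def binVec (x y : Fin d → ℝ) (θ : Torus d) : Fin d → ℤ := fun i => binDiffCirc (x i) (y i) (θ i)

/-- `binVec` is measurable. [folklore] -/
private theorem measurable_binVec (x y : Fin d → ℝ) : Measurable (binVec x y) :=
  measurable_pi_lambda _ fun i => (measurable_binDiffCirc (x i) (y i)).comp (measurable_pi_apply i)

/-- The torus-average kernel `K (x, y) = ∫_{𝕋ᵈ} C (⌊x - θ⌋ - ⌊y - θ⌋) dθ`. [folklore] -/
def torusKernel (C : (Fin d → ℤ) → ℂ) (x y : Fin d → ℝ) : ℂ :=
  ∫ θ : Torus d, C (binVec x y θ)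

/-- The kernel integrand is measurable (`ℤᵈ` is countable and discrete). [folklore] -/
private theorem measurable_comp_binVec (C : (Fin d → ℤ) → ℂ) (x y : Fin d → ℝ) :
    Measurable fun θ : Torus d => C (binVec x y θ) :=
  (measurable_of_countable C).comp (measurable_binVec x y)

/-- Translation invariance: `K (x + s, y + s) = K (x, y)` (Haar invariance on `𝕋ᵈ`). [folklore] -/
private theorem torusKernel_add_right (C : (Fin d → ℤ) → ℂ) (x y s : Fin d → ℝ) :
    torusKernel C (x + s) (y + s) = torusKernel C x y := by
  unfold torusKernel
  have h : ∀ θ : Torus d, binVec (x + s) (y + s) θ =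
      binVec x y (θ - fun i => ((s i : ℝ) : AddCircle (1 : ℝ))) := by
    intro θ
    funext i
    simp only [binVec, Pi.add_apply, Pi.sub_apply]
    exact binDiffCirc_add_right (x i) (y i) (s i) (θ i)
  simp_rw [h]
  exact integral_sub_right_eq_self (μ := (volume : Measure (Torus d)))
    (fun θ => C (binVec x y θ)) _

/-- `K (x, x) = C 0`. [folklore] -/
private theorem torusKernel_self_zero (C : (Fin d → ℤ) → ℂ) (x : Fin d → ℝ) : torusKernel C x x = C 0 := by
  unfold torusKernel
  have h : ∀ θ : Torus d, binVec x x θ = 0 := fun θ => funext fun i => by simp [binVec]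
  simp_rw [h]
  simp

/-- `K (r, 0) = C r` at integer points `r`. [folklore] -/
private theorem torusKernel_intCast_zero (C : (Fin d → ℤ) → ℂ) (r : Fin d → ℤ) :
    torusKernel C (fun i => (r i : ℝ)) 0 = C r := by
  unfold torusKernel
  have h : ∀ θ : Torus d, binVec (fun i => (r i : ℝ)) 0 θ = r := fun θ => funext fun i => by
    simp only [binVec, Pi.zero_apply]
    exact binDiffCirc_intCast_zero (r i) (θ i)
  simp_rw [h]
  simp


/-- The kernel integrand is integrable for positive-definite `C` (it is bounded by `re (C 0)` and the
torus has finite measure). [folklore] -/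
private theorem integrable_comp_binVec {C : (Fin d → ℤ) → ℂ} (hC : IsPositiveDefinite C) (x y : Fin d → ℝ) :
    Integrable (fun θ : Torus d => C (binVec x y θ)) :=
  Integrable.mono' (integrable_const (C 0).re) (measurable_comp_binVec C x y).aestronglyMeasurable
    (ae_of_all _ fun _ => IsPositiveDefinite.norm_apply_le_holds hC _)

/-- The **tent interpolant** `C̃ (u) = K (u, 0) = ∫_{𝕋ᵈ} C (⌊u - θ⌋ - ⌊-θ⌋) dθ` of `C` on `ℝᵈ`
(`= ∑_r C r ∏ᵢ (1 - |uᵢ - rᵢ|)₊`, though we never need the closed form). [folklore] -/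
def tentInterp (C : (Fin d → ℤ) → ℂ) (u : EuclideanSpace ℝ (Fin d)) : ℂ :=
  torusKernel C (fun i => u i) 0

/-- `K (x, y) = C̃ (x - y)`. [folklore] -/
private theorem torusKernel_eq_tentInterp_sub (C : (Fin d → ℤ) → ℂ) (x y : EuclideanSpace ℝ (Fin d)) :
    torusKernel C (fun i => x i) (fun i => y i) = tentInterp C (x - y) := by
  unfold tentInterp
  rw [← torusKernel_add_right C (fun i => x i) (fun i => y i) (fun i => -y i)]
  have h1 : ((fun i => x i) + fun i => -y i) = fun i => (x - y) i := by
    funext i; simp [sub_eq_add_neg]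
  have h2 : ((fun i => y i) + fun i => -y i) = (0 : Fin d → ℝ) := by
    funext i; simp
  rw [h1, h2]

/-- `C̃ 0 = C 0`. [folklore] -/
private theorem tentInterp_zero (C : (Fin d → ℤ) → ℂ) : tentInterp C 0 = C 0 := by
  unfold tentInterp
  exact torusKernel_self_zero C _

/-- `C̃` interpolates `C` at the integer points. [folklore] -/
private theorem tentInterp_intCast (C : (Fin d → ℤ) → ℂ) (r : Fin d → ℤ) :
    tentInterp C (WithLp.toLp 2 fun i => (r i : ℝ)) = C r := by
  unfold tentInterp
  have h : (fun i => (WithLp.toLp 2 fun i => (r i : ℝ) : EuclideanSpace ℝ (Fin d)) i) =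
      fun i => (r i : ℝ) := by
    funext i; simp
  rw [h]
  exact torusKernel_intCast_zero C r

/-- The tent interpolant of a positive-definite function on `ℤᵈ` is positive definite on `ℝᵈ`: its
quadratic form at `x₁, …, xₙ` is the `𝕋ᵈ`-average of the quadratic form of `C` at the integer points
`⌊xₖ - θ⌋`. [folklore] -/
private theorem isPositiveDefinite_tentInterp {C : (Fin d → ℤ) → ℂ} (hC : IsPositiveDefinite C) :
    IsPositiveDefinite (tentInterp C) := by
  intro n x c
  set F : Torus d → ℂ :=
    fun θ => ∑ i, ∑ j, conj (c i) * c j * C (binVec (fun k => x j k) (fun k => x i k) θ) with hF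
  have hFi : ∀ i j, Integrable (fun θ : Torus d =>
      conj (c i) * c j * C (binVec (fun k => x j k) (fun k => x i k) θ)) :=
    fun i j => (integrable_comp_binVec hC _ _).const_mul _
  have key : (∑ i, ∑ j, conj (c i) * c j * tentInterp C (x j - x i)) = ∫ θ, F θ := by
    rw [hF, integral_finsetSum _ (fun i _ => integrable_finsetSum _ fun j _ => hFi i j)]
    refine Finset.sum_congr rfl fun i _ => ?_
    rw [integral_finsetSum _ (fun j _ => hFi i j)]
    refine Finset.sum_congr rfl fun j _ => ?_
    rw [integral_const_mul, ← torusKernel_eq_tentInterp_sub]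
    rfl
  have hpt : ∀ θ : Torus d, 0 ≤ (F θ).re ∧ (F θ).im = 0 := by
    intro θ
    choose t ht using fun k => QuotientAddGroup.mk_surjective (θ k)
    have hz : ∀ i j, binVec (fun k => x j k) (fun k => x i k) θ =
        (fun k => ⌊x j k - t k⌋) - (fun k => ⌊x i k - t k⌋) := by
      intro i j
      funext k
      simp only [binVec, Pi.sub_apply]
      rw [← ht k]
      exact binDiffCirc_coe _ _ _
    simp only [hF, hz]
    exact hC n (fun m k => ⌊x m k - t k⌋) c
  have hFint : Integrable F :=
    integrable_finsetSum _ fun i _ => integrable_finsetSum _ fun j _ => hFi i j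
  refine ⟨?_, ?_⟩
  · rw [key]
    have h := integral_re hFint
    simp only [RCLike.re_to_complex] at h
    rw [← h]
    exact integral_nonneg fun θ => (hpt θ).1
  · rw [key]
    have h := integral_im hFint
    simp only [RCLike.im_to_complex] at h
    rw [← h]
    simp [fun θ => (hpt θ).2]

/-- Haar measure on `ℝ / ℤ` has no atoms. [folklore] -/
instance : NullSingletonClass (volume : Measure (AddCircle (1 : ℝ))) := by
  refine ⟨fun x => nonpos_iff_eq_zero.mp ?_⟩
  calc volume {x} ≤ volume (Metric.closedBall x 0) :=
        measure_mono (by simp)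
    _ = 0 := by rw [AddCircle.volume_closedBall]; simp

/-- The floor is locally constant off the integers: if `a₀ - t ∉ ℤ` (stated as
`(t : ℝ/ℤ) ≠ (a₀ : ℝ/ℤ)`), then `⌊a - t⌋ = ⌊a₀ - t⌋` for all `a` near `a₀`. [folklore] -/
private theorem eventually_floor_sub_eq {a₀ t : ℝ} (h : ((t : ℝ) : AddCircle (1 : ℝ)) ≠ ((a₀ : ℝ) : AddCircle (1 : ℝ))) :
    ∀ᶠ a in 𝓝 a₀, ⌊a - t⌋ = ⌊a₀ - t⌋ := by
  set m := ⌊a₀ - t⌋ with hm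
  have hne : (m : ℝ) ≠ a₀ - t := by
    intro hmt
    apply h
    rw [eq_comm, QuotientAddGroup.eq, AddSubgroup.mem_zmultiples_iff]
    exact ⟨-m, by simp; linarith⟩
  have hlo : (m : ℝ) < a₀ - t := lt_of_le_of_ne (Int.floor_le _) hne
  have hhi : a₀ - t < m + 1 := Int.lt_floor_add_one _
  have hmem : ∀ᶠ a in 𝓝 a₀, a - t ∈ Set.Ioo (m : ℝ) (m + 1) :=
    (continuous_id.sub continuous_const).continuousAt.eventually_mem (Ioo_mem_nhds hlo hhi)
  filter_upwards [hmem] with a ha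
  exact Int.floor_eq_iff.2 ⟨ha.1.le, ha.2⟩

/-- The tent interpolant of a positive-definite function is continuous (dominated convergence: for
a.e. `θ` the integrand is locally constant in `u`). [folklore] -/
private theorem continuous_tentInterp {C : (Fin d → ℤ) → ℂ} (hC : IsPositiveDefinite C) :
    Continuous (tentInterp C) := by
  refine continuous_iff_continuousAt.2 fun u₀ => ?_
  unfold tentInterp torusKernel
  refine MeasureTheory.continuousAt_of_dominated (bound := fun _ => (C 0).re) ?_ ?_ (integrable_const _) ?_
  · exact Eventually.of_forall fun u => (measurable_comp_binVec C _ _).aestronglyMeasurable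
  · exact Eventually.of_forall fun u => ae_of_all _ fun θ =>
      IsPositiveDefinite.norm_apply_le_holds hC _
  · have hnull : ∀ᵐ θ ∂(volume : Measure (Torus d)), ∀ i, θ i ≠ ((u₀ i : ℝ) : AddCircle (1 : ℝ)) := by
      refine ae_all_iff.2 fun i => ?_
      rw [volume_pi]
      exact Measure.ae_eval_ne _ i _
    filter_upwards [hnull] with θ hθ
    choose t ht using fun k => QuotientAddGroup.mk_surjective (θ k)
    have hev : ∀ᶠ u in 𝓝 u₀, ∀ k, ⌊u k - t k⌋ = ⌊u₀ k - t k⌋ := by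
      refine eventually_all.2 fun k => ?_
      have hk : ((t k : ℝ) : AddCircle (1 : ℝ)) ≠ ((u₀ k : ℝ) : AddCircle (1 : ℝ)) := by
        rw [ht k]; exact hθ k
      exact ((show Continuous fun u : EuclideanSpace ℝ (Fin d) => u k by fun_prop).tendsto u₀).eventually
        (eventually_floor_sub_eq hk)
    refine (continuousAt_const (y := C (binVec (fun i => u₀ i) 0 θ))).congr_of_eventuallyEq ?_
    filter_upwards [hev] with u hu
    congr 1
    funext i
    simp only [binVec, Pi.zero_apply]
    rw [← ht i, binDiffCirc_coe, binDiffCirc_coe]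
    simp [binDiff, hu i]

end HerglotzZd

open HerglotzZd in
/-- **Herglotz's theorem on `ℤᵈ`** (existence half; Katznelson Ch. I §7.6 for `d = 1`, Weil's
Herglotz–Bochner theorem for the discrete group `ℤᵈ`, Ch. VII §4): a positive-definite function
`C : ℤᵈ → ℂ` is represented by a finite positive measure `μ` on `ℝᵈ`,
`C r = ∫ exp (i ∑ᵢ rᵢ ξᵢ) dμ(ξ)` for every `r ∈ ℤᵈ` (Mathlib's `charFun` sign convention; push `μ`
forward to `ℝᵈ / 2πℤᵈ` for the measure on the torus of the printed statement). Proof: Bochner's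
theorem on `ℝᵈ` (`bochner_holds`) applied to the tent interpolant.
[cite: Katznelson2004, Ch. I §7.6 Theorem (Herglotz); Ch. VII §4] -/
theorem IsPositiveDefinite.exists_measure_integral_exp_eq {d : ℕ} {C : (Fin d → ℤ) → ℂ}
    (hC : IsPositiveDefinite C) :
    ∃ μ : Measure (EuclideanSpace ℝ (Fin d)), IsFiniteMeasure μ ∧
      ∀ r : Fin d → ℤ, ∫ ξ, exp ((∑ i, (r i : ℝ) * ξ i : ℝ) * I) ∂μ = C r := by
  have h0im := hC.apply_zero_im
  rcases eq_or_lt_of_le hC.apply_zero_re_nonneg with h0 | h0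
  · refine ⟨0, inferInstance, fun r => ?_⟩
    have hr : C r = 0 := by
      have := IsPositiveDefinite.norm_apply_le_holds hC r
      rw [← h0] at this
      exact norm_le_zero_iff.mp this
    simp [hr]
  · set c₀ : ℝ := (C 0).re with hc₀
    have hc₀ne : c₀ ≠ 0 := h0.ne'
    have hC0 : C 0 = c₀ := Complex.ext (by simp [hc₀]) (by simp [h0im])
    set C' : (Fin d → ℤ) → ℂ := fun z => C z / c₀ with hC'
    have hC'pd : IsPositiveDefinite C' := by
      intro n x c
      have hsum : (∑ i, ∑ j, conj (c i) * c j * C' (x j - x i)) =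
          (∑ i, ∑ j, conj (c i) * c j * C (x j - x i)) / c₀ := by
        rw [Finset.sum_div]
        refine Finset.sum_congr rfl fun i _ => ?_
        rw [Finset.sum_div]
        refine Finset.sum_congr rfl fun j _ => ?_
        simp only [hC']
        ring
      rw [hsum]
      obtain ⟨hre, him⟩ := hC n x c
      refine ⟨?_, ?_⟩
      · rw [Complex.div_ofReal_re]; exact div_nonneg hre h0.le
      · rw [Complex.div_ofReal_im, him, zero_div]
    have hC'0 : C' 0 = 1 := by
      simp only [hC', hC0]
      exact div_self (by exact_mod_cast hc₀ne)
    have h1 : tentInterp C' 0 = 1 := by rw [tentInterp_zero, hC'0]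
    obtain ⟨μ', hμ'P, hμ'C⟩ := IsPositiveDefinite.exists_charFun_eq_holds
      (isPositiveDefinite_tentInterp hC'pd) (continuous_tentInterp hC'pd) h1
    refine ⟨c₀.toNNReal • μ', inferInstance, fun r => ?_⟩
    rw [integral_smul_nnreal_measure]
    have hchar : charFun μ' (WithLp.toLp 2 fun i => (r i : ℝ)) = C' r := by
      rw [hμ'C]; exact tentInterp_intCast C' r
    have hint : ∫ ξ, exp ((∑ i, (r i : ℝ) * ξ i : ℝ) * I) ∂μ' = C' r := by
      rw [← hchar, charFun_apply]
      refine integral_congr_ae (ae_of_all _ fun ξ => ?_)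
      simp [PiLp.inner_apply, mul_comm]
    rw [hint]
    simp only [hC']
    rw [NNReal.smul_def, Real.coe_toNNReal _ h0.le, Complex.real_smul, ← mul_div_assoc]
    exact mul_div_cancel_left₀ (C r) (by exact_mod_cast hc₀ne)

open HerglotzZd in
/-- The easy half of Herglotz's theorem: the Fourier–Stieltjes transform of a finite positive measure,
sampled at the integer frequencies, is positive definite on `ℤᵈ` (Katznelson (7.8):
`∑ a_{n-m} z_n \bar z_m = ∫ |∑ z_n e^{-int}|² dμ ≥ 0`); here via Mathlib's `charFun` and
`isPositiveDefinite_charFun`. [cite: Katznelson2004, Ch. I §7.6 Theorem (Herglotz), eq. (7.8)] -/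
theorem isPositiveDefinite_of_integral_exp_eq {d : ℕ} {C : (Fin d → ℤ) → ℂ}
    (μ : Measure (EuclideanSpace ℝ (Fin d))) [IsFiniteMeasure μ]
    (hμ : ∀ r : Fin d → ℤ, ∫ ξ, exp ((∑ i, (r i : ℝ) * ξ i : ℝ) * I) ∂μ = C r) :
    IsPositiveDefinite C := by
  set e : (Fin d → ℤ) → EuclideanSpace ℝ (Fin d) := fun m => WithLp.toLp 2 fun k => (m k : ℝ)
    with he
  have hC : ∀ r, C r = charFun μ (e r) := by
    intro r
    rw [← hμ r, charFun_apply]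
    refine integral_congr_ae (ae_of_all _ fun ξ => ?_)
    simp [he, PiLp.inner_apply, mul_comm]
  have hsub : ∀ a b : Fin d → ℤ, e (a - b) = e a - e b := by
    intro a b
    simp only [he]
    ext k
    simp
  intro n x c
  have h := isPositiveDefinite_charFun μ n (fun m => e (x m)) c
  simp_rw [hC, hsub]
  exact h

end Literature.Analysis.FunctionSpaces
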